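import Mathlib
import HarnessLib

/-!
# Invariant subspaces, orbit closures, non-cyclic vectors (shared vocabulary)

Source under adjudication: Per H. Enflo, *On the invariant subspace problem in Hilbert spaces*, arXiv:2305.15442 (v1
2023, v2 2024), bib key `Enflo2023` — a CLAIMED proof of the invariant subspace problem for operators on a separable
Hilbert space.  This file is part of the kernel-tight typing of the manuscript by the b2b-enflo repair cell
(formaliser 2, Part B: (28)–(47), the limiting argument and the final deduction).  It records what FOLLOWS (proved
implications from the manuscript's displayed hypotheses) and, where a step does not follow, the typed inference
together with its refutation.  NOTHING here asserts that the manuscript's main theorem holds; no declaration concludes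
the invariant subspace problem for an arbitrary operator.  Value (BLOCK-2b): theorems / refutations of typed
inferences about a text — not progress on the problem.

EnfloISP — repair cell ENFLO ISP (arXiv:2305.15442).  SHARED basic vocabulary (created by formaliser 2; Part A imports
it; Part B = the limiting argument and the final deduction builds on it): invariance, the target predicate
`HasNontrivialClosedInvariantSubspace T`, the orbit closure `orbitClosure T y` (closed span of {T^j y}, operator
powers), non-cyclicity, and the elementary deduction "orbit orthogonal to a non-zero vector ⇒ non-trivial closed
invariant subspace" (v2 p.3 (C' = 0), eq. (11)/(12) pp.4–5, type-2 endgame p.23).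
The referee's independent record (the referee modules, unit b2b-enflo-3) has the same notions under the names
`HasNIS` / `cyclicSubspace` (function iterates; tree file `RefereeCompetitor.lean`); the two vocabularies coincide
(`Function.iterate` vs operator powers: `(T ^ j) y = T^[j] y`), a bridge file is staged in the cell's folder, not in the tree.
Origin: planner-b2b-enflo-2-0 (formaliser 2), 2026-08-18.  Mathlib only.
-/

open scoped InnerProductSpace
open Filter Topology

namespace Literature.Analysis.OperatorTheory.Enflo2023

variable {H : Type*} [NormedAddCommGroup H] [InnerProductSpace ℂ H]

/-- A (linear) subspace `M` is invariant under `T` if `T` maps it into itself. [folklore] -/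
def IsInvariant (T : H →L[ℂ] H) (M : Submodule ℂ H) : Prop := ∀ x ∈ M, T x ∈ M

/-- `IsInvariant` is Mathlib's invariant-submodule notion `Module.End.invtSubmodule` for the underlying linear map
(kept as a one-line predicate for readability of the statements below). [folklore] -/
theorem isInvariant_iff_mem_invtSubmodule (T : H →L[ℂ] H) (M : Submodule ℂ H) :
    IsInvariant T M ↔ M ∈ Module.End.invtSubmodule (T : H →ₗ[ℂ] H) := by
  rw [Module.End.mem_invtSubmodule]; exact Iff.rfl

/-- The conclusion of the Invariant Subspace Problem for `T`: a closed subspace, neither `0` nor `H`,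
mapped into itself by `T`. [folklore] -/
def HasNontrivialClosedInvariantSubspace (T : H →L[ℂ] H) : Prop :=
  ∃ M : Submodule ℂ H, IsClosed (M : Set H) ∧ M ≠ ⊥ ∧ M ≠ ⊤ ∧ IsInvariant T M

/-- The closed linear span of the orbit `{T^j y : j ≥ 0}` (the cyclic subspace generated by `y`). [folklore] -/
noncomputable def orbitClosure (T : H →L[ℂ] H) (y : H) : Submodule ℂ H :=
  (Submodule.span ℂ (Set.range fun j : ℕ => (T ^ j) y)).topologicalClosure

/-- `y` is non-cyclic for `T` if its orbit does not span a dense subspace. [folklore] -/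
def IsNonCyclic (T : H →L[ℂ] H) (y : H) : Prop := orbitClosure T y ≠ ⊤

/-- The orbit closure is a closed subspace. [folklore] -/
lemma isClosed_orbitClosure (T : H →L[ℂ] H) (y : H) : IsClosed (orbitClosure T y : Set H) :=
  Submodule.isClosed_topologicalClosure _

/-- The generating vector lies in its orbit closure (`j = 0`). [folklore] -/
lemma self_mem_orbitClosure (T : H →L[ℂ] H) (y : H) : y ∈ orbitClosure T y := by
  refine Submodule.le_topologicalClosure _ (Submodule.subset_span ⟨0, ?_⟩)
  simp

/-- Every iterate `T^j y` lies in the orbit closure of `y`. [folklore] -/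
lemma pow_apply_mem_orbitClosure (T : H →L[ℂ] H) (y : H) (j : ℕ) : (T ^ j) y ∈ orbitClosure T y :=
  Submodule.le_topologicalClosure _ (Submodule.subset_span ⟨j, rfl⟩)

/-- The orbit closure is invariant under `T`. [folklore] -/
lemma isInvariant_orbitClosure (T : H →L[ℂ] H) (y : H) : IsInvariant T (orbitClosure T y) := by
  -- `T` maps the span of the orbit into itself, hence (by continuity) also its closure.
  intro x hx
  have hspan : Set.MapsTo T (Submodule.span ℂ (Set.range fun j : ℕ => (T ^ j) y) : Set H)
      (Submodule.span ℂ (Set.range fun j : ℕ => (T ^ j) y) : Set H) := by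
    intro z hz
    have : (Submodule.span ℂ (Set.range fun j : ℕ => (T ^ j) y)).map (T : H →ₗ[ℂ] H)
        ≤ Submodule.span ℂ (Set.range fun j : ℕ => (T ^ j) y) := by
      rw [Submodule.map_span_le]
      rintro _ ⟨j, rfl⟩
      refine Submodule.subset_span ⟨j + 1, ?_⟩
      simp [pow_succ']
    exact this ⟨z, hz, rfl⟩
  have hcl := hspan.closure T.continuous
  have hx' : x ∈ closure (Submodule.span ℂ (Set.range fun j : ℕ => (T ^ j) y) : Set H) := by
    rw [← Submodule.topologicalClosure_coe]; exact hx
  have := hcl hx'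
  rw [← Submodule.topologicalClosure_coe] at this
  exact this

/-- If the orbit of a non-zero vector `y` is orthogonal to a non-zero vector `x₀`, then `T` has a
non-trivial closed invariant subspace (namely the orbit closure of `y`).  This is the deduction used
at v2 p.3 ("if `C' = 0` then `y₀` is non-cyclic"), at (11)–(12), and in the type-2 endgame p.23. [folklore] -/
theorem hasNontrivialClosedInvariantSubspace_of_orbit_orthogonal (T : H →L[ℂ] H) {y x₀ : H}
    (hy : y ≠ 0) (hx₀ : x₀ ≠ 0) (horth : ∀ j : ℕ, ⟪(T ^ j) y, x₀⟫_ℂ = 0) :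
    HasNontrivialClosedInvariantSubspace T := by
  refine ⟨orbitClosure T y, isClosed_orbitClosure T y, ?_, ?_, isInvariant_orbitClosure T y⟩
  · intro hbot
    have := self_mem_orbitClosure T y
    rw [hbot, Submodule.mem_bot] at this
    exact hy this
  · -- `x₀ ⟂ orbitClosure T y`, so `x₀ ∉ orbitClosure T y` (else `⟪x₀,x₀⟫ = 0`), so it is not `⊤`.
    intro htop
    have hle : orbitClosure T y ≤ (ℂ ∙ x₀)ᗮ := by
      refine Submodule.topologicalClosure_minimal _ ?_ (Submodule.isClosed_orthogonal _)
      rw [Submodule.span_le]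
      rintro _ ⟨j, rfl⟩
      rw [SetLike.mem_coe, Submodule.mem_orthogonal_singleton_iff_inner_left]
      exact horth j
    have hx : x₀ ∈ (ℂ ∙ x₀)ᗮ := hle (htop ▸ Submodule.mem_top)
    rw [Submodule.mem_orthogonal_singleton_iff_inner_left, inner_self_eq_zero] at hx
    exact hx₀ hx

/-- Variant with the orthogonality written as `⟪x₀, T^j y⟫ = 0`. [folklore] -/
theorem hasNontrivialClosedInvariantSubspace_of_orbit_orthogonal' (T : H →L[ℂ] H) {y x₀ : H}
    (hy : y ≠ 0) (hx₀ : x₀ ≠ 0) (horth : ∀ j : ℕ, ⟪x₀, (T ^ j) y⟫_ℂ = 0) :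
    HasNontrivialClosedInvariantSubspace T :=
  hasNontrivialClosedInvariantSubspace_of_orbit_orthogonal T hy hx₀ fun j => by
    rw [← inner_conj_symm, horth j, map_zero]

/-- A non-zero non-cyclic vector gives a non-trivial closed invariant subspace. [folklore] -/
theorem hasNontrivialClosedInvariantSubspace_of_isNonCyclic (T : H →L[ℂ] H) {y : H} (hy : y ≠ 0)
    (hnc : IsNonCyclic T y) : HasNontrivialClosedInvariantSubspace T := by
  refine ⟨orbitClosure T y, isClosed_orbitClosure T y, ?_, hnc, isInvariant_orbitClosure T y⟩
  intro hbot
  have := self_mem_orbitClosure T y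
  rw [hbot, Submodule.mem_bot] at this
  exact hy this

end Literature.Analysis.OperatorTheory.Enflo2023
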